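import Summits.Schanuel.Schanuel.Theorems.ZilberEacRelationPuiseux
import Summits.Schanuel.Schanuel.Theorems.ZilberEacFibreCurvePuiseuxGeneral
import HarnessLib

/-!
# The exponential-polynomial regime, CXIX: THE `y₁`-ADIC REDUCTION OF A FIBRE RELATION
# MODULO THE CURVE

HONEST FRAMING.  Cell `pub-schanuel` (Zilber's Exponential-Algebraic Closedness, case ladder;
host summit Schanuel), seat 2, gen 35.  Pure commutative algebra for the `∀ W` theorem of
Mantova–Masser's exponential-polynomial regime (O92 (a)).  A relation
`P ∈ ℂ[x₀, x₁, y₁][y₀]` with some coefficient not divisible by the curve polynomial `F` (viewed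
in `ℂ[x₀, x₁, y₁]`) is written `y₁`-adically modulo `F`: with `r` the least `y₁`-order of a
coefficient `P_{ij} ∈ ℂ[x₀][x₁]` not divisible by `F` (`P = Σ_{i,j} P_{ij} y₁^j y₀^i`),
`P ≡ y₁^r · P' (mod F)` at every point of the curve, and the degenerate part
`G₀ := P'|_{y₁ = 0} = Σ_i P_{ir} y₀^i ∈ ℂ[x₀][x₁][y₀]` has a coefficient not divisible by `F`:
**`exists_yOneAdicReduction`** (values form, which is what the density engine consumes).
[folklore]; nothing here is specific to Schanuel's conjecture (neither used nor implied);
Mantova–Masser's question (PLMS 2024 §1 p. 5) and EC(3,2) stay OPEN; EAC ⇏ SC.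
-/

noncomputable section

open Polynomial

set_option linter.dupNamespace false

namespace Summit.Schanuel.Schanuel.Theorems

section YOneAdicReduction

/-! ## Part A. Row sums -/

/-- Coefficients of `Σ_{j ≤ n} C(a_j) X^j`. [folklore] -/
theorem coeff_rangeSum_C_mul_X_pow {R : Type*} [Semiring R] (a : ℕ → R) (n i : ℕ) :
    (∑ j ∈ Finset.range (n + 1), Polynomial.C (a j) * Polynomial.X ^ j : Polynomial R).coeff i =
      if i < n + 1 then a i else 0 := by
  rw [Polynomial.finsetSum_coeff]
  simp only [Polynomial.coeff_C_mul_X_pow]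
  rw [Finset.sum_ite_eq (Finset.range (n + 1)) i]
  simp only [Finset.mem_range]

/-- Degree of `Σ_{j ≤ n} C(a_j) X^j`. [folklore] -/
theorem natDegree_rangeSum_C_mul_X_pow_le {R : Type*} [Semiring R] (a : ℕ → R) (n : ℕ) :
    (∑ j ∈ Finset.range (n + 1), Polynomial.C (a j) * Polynomial.X ^ j : Polynomial R).natDegree ≤ n := by
  rw [Polynomial.natDegree_le_iff_coeff_eq_zero]
  intro i hi
  rw [coeff_rangeSum_C_mul_X_pow, if_neg (by omega)]

/-- Coefficients of a truncation `Σ_{j < r} C(a_j) X^j`. [folklore] -/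
theorem coeff_rangeSum_C_mul_X_pow_lt {R : Type*} [Semiring R] (a : ℕ → R) (r i : ℕ) :
    (∑ j ∈ Finset.range r, Polynomial.C (a j) * Polynomial.X ^ j : Polynomial R).coeff i =
      if i < r then a i else 0 := by
  rw [Polynomial.finsetSum_coeff]
  simp only [Polynomial.coeff_C_mul_X_pow]
  rw [Finset.sum_ite_eq (Finset.range r) i]
  simp only [Finset.mem_range]

/-! ## Part B. The reduction -/

variable (F : ℂ[X][X])

/-- **THE `y₁`-ADIC REDUCTION MODULO THE CURVE (values form).**  `F₃` = `F` inside
`ℂ[x₀, x₁, y₁]` (through its values); `P ∈ ℂ[x₀, x₁, y₁][y₀]` with a coefficient not divisible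
by `F₃`.  There are `r`, `P' ∈ ℂ[x₀, x₁, y₁][y₀]` and `G₀ ∈ ℂ[x₀][x₁][y₀]` with:
`P(x, y₁; y) = y₁^r P'(x, y₁; y)` whenever `F(x) = 0`; `G₀(x; y) = P'(x, 0; y)` for all
`x, y`; and some coefficient of `G₀` is not divisible by `F`. [folklore] (new in this form) -/
theorem exists_yOneAdicReduction (F₃ : MvPolynomial (Fin 3) ℂ)
    (hF₃ : ∀ v : Fin 3 → ℂ, MvPolynomial.eval v F₃ = (F.map (Polynomial.evalRingHom (v 0))).eval (v 1))
    (P : Polynomial (MvPolynomial (Fin 3) ℂ)) (hP : ∃ i, ¬ F₃ ∣ P.coeff i) :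
    ∃ (r : ℕ) (P' : Polynomial (MvPolynomial (Fin 3) ℂ)) (G₀ : Polynomial ℂ[X][X]),
      (∀ x₀ x₁ y₁ y : ℂ, (F.map (Polynomial.evalRingHom x₀)).eval x₁ = 0 →
        (P.map (MvPolynomial.eval ![x₀, x₁, y₁])).eval y =
          y₁ ^ r * (P'.map (MvPolynomial.eval ![x₀, x₁, y₁])).eval y) ∧
      (∀ x₀ x₁ y : ℂ, (G₀.map (Polynomial.eval₂RingHom (Polynomial.evalRingHom x₀) x₁)).eval y =
        (P'.map (MvPolynomial.eval ![x₀, x₁, 0])).eval y) ∧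
      ∃ i, ¬ F ∣ G₀.coeff i := by
  classical
  obtain ⟨κ, hκ⟩ := exists_rowsEquiv₃
  -- `κ⁻¹ (C F) = F₃` (same values)
  have hκF : κ.symm (Polynomial.C F) = F₃ := by
    refine MvPolynomial.funext fun v => ?_
    have e : v = ![v 0, v 1, v 2] := by funext i; fin_cases i <;> rfl
    rw [hF₃, e, hκ, RingEquiv.apply_symm_apply, Polynomial.map_C, Polynomial.eval_C,
      Polynomial.coe_eval₂RingHom, Polynomial.eval₂_eq_eval_map]
    rfl
  -- the rows `Q i = κ(P_i) ∈ ℂ[x₀][x₁][y₁]`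
  set Q : ℕ → Polynomial ℂ[X][X] := fun i => κ (P.coeff i) with hQ
  -- some `P_{ij}` is not divisible by `F`
  have hex : ∃ j, ∃ i, ¬ F ∣ (Q i).coeff j := by
    obtain ⟨i₀, hi₀⟩ := hP
    by_contra hall
    push Not at hall
    obtain ⟨T, hT⟩ := (Polynomial.C_dvd_iff_dvd_coeff F (Q i₀)).2 fun j => hall j i₀
    apply hi₀
    refine ⟨κ.symm T, ?_⟩
    apply κ.injective
    rw [map_mul, RingEquiv.apply_symm_apply, ← hκF, RingEquiv.apply_symm_apply]
    exact hT
  -- the least `y₁`-order `r`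
  obtain ⟨r, hr, hrbelow⟩ : ∃ r, (∃ i, ¬ F ∣ (Q i).coeff r) ∧ ∀ j, j < r → ∀ i, F ∣ (Q i).coeff j := by
    refine ⟨Nat.find hex, Nat.find_spec hex, fun j hj => ?_⟩
    have h := Nat.find_min hex hj
    push Not at h
    exact h
  -- `Q i = X^r · Sh i + (lower part ≡ 0 mod F)`
  set low : ℕ → Polynomial ℂ[X][X] := fun i =>
    ∑ j ∈ Finset.range r, Polynomial.C ((Q i).coeff j) * Polynomial.X ^ j with hlow
  have hlowc : ∀ i j, (low i).coeff j = if j < r then (Q i).coeff j else 0 :=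
    fun i j => coeff_rangeSum_C_mul_X_pow_lt (fun j => (Q i).coeff j) r j
  have hlowdvd : ∀ i j, F ∣ (low i).coeff j := by
    intro i j
    rw [hlowc]
    split_ifs with h
    · exact hrbelow j h i
    · exact dvd_zero F
  have hdvdX : ∀ i, (Polynomial.X : Polynomial ℂ[X][X]) ^ r ∣ Q i - low i := by
    intro i
    rw [Polynomial.X_pow_dvd_iff]
    intro j hj
    rw [Polynomial.coeff_sub, hlowc, if_pos hj, sub_self]
  choose Sh hSh using hdvdX
  have hSh0 : ∀ i, (Sh i).coeff 0 = (Q i).coeff r := by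
    intro i
    have h := congrArg (fun T : Polynomial ℂ[X][X] => T.coeff r) (hSh i)
    simp only [Polynomial.coeff_sub, Polynomial.coeff_X_pow_mul', le_refl, if_true,
      Nat.sub_self] at h
    rw [← h, hlowc, if_neg (lt_irrefl r), sub_zero]
  -- the reduced relation and its degenerate part
  set n : ℕ := P.natDegree with hn
  set P' : Polynomial (MvPolynomial (Fin 3) ℂ) :=
    ∑ i ∈ Finset.range (n + 1), Polynomial.C (κ.symm (Sh i)) * Polynomial.X ^ i with hP'
  set G₀ : Polynomial ℂ[X][X] :=
    ∑ i ∈ Finset.range (n + 1), Polynomial.C ((Sh i).coeff 0) * Polynomial.X ^ i with hG₀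
  have hP'c : ∀ i, P'.coeff i = if i < n + 1 then κ.symm (Sh i) else 0 :=
    fun i => coeff_rangeSum_C_mul_X_pow (fun i => κ.symm (Sh i)) n i
  have hG₀c : ∀ i, G₀.coeff i = if i < n + 1 then (Sh i).coeff 0 else 0 :=
    fun i => coeff_rangeSum_C_mul_X_pow (fun i => (Sh i).coeff 0) n i
  have hP'deg : P'.natDegree ≤ n := natDegree_rangeSum_C_mul_X_pow_le _ n
  have hG₀deg : G₀.natDegree ≤ n := natDegree_rangeSum_C_mul_X_pow_le _ n
  refine ⟨r, P', G₀, fun x₀ x₁ y₁ y hFx => ?_, fun x₀ x₁ y => ?_, ?_⟩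
  · -- `P = y₁^r P'` on the curve
    set f : ℂ[X][X] →+* ℂ := Polynomial.eval₂RingHom (Polynomial.evalRingHom x₀) x₁ with hf
    have hfF : f F = 0 := by
      rw [hf, Polynomial.coe_eval₂RingHom, Polynomial.eval₂_eq_eval_map]
      exact hFx
    have hrowi : ∀ i, MvPolynomial.eval ![x₀, x₁, y₁] (P.coeff i) =
        y₁ ^ r * ((Sh i).map f).eval y₁ := by
      intro i
      have e : Q i = Polynomial.X ^ r * Sh i + low i := by rw [← hSh i]; ring
      rw [hκ, show κ (P.coeff i) = Q i from rfl, e, Polynomial.map_add, Polynomial.map_mul,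
        Polynomial.map_pow, Polynomial.map_X, Polynomial.eval_add, Polynomial.eval_mul,
        Polynomial.eval_pow, Polynomial.eval_X, eval_map_eq_zero_of_forall_dvd F (hlowdvd i) f hfF,
        add_zero]
    have hrowi' : ∀ i ∈ Finset.range (n + 1), MvPolynomial.eval ![x₀, x₁, y₁] (P'.coeff i) =
        ((Sh i).map f).eval y₁ := by
      intro i hi
      rw [hP'c, if_pos (Finset.mem_range.1 hi), hκ, RingEquiv.apply_symm_apply]
    rw [eval_map_eq_rowSum P _ le_rfl, eval_map_eq_rowSum P' _ hP'deg, Finset.mul_sum]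
    refine Finset.sum_congr rfl fun i hi => ?_
    rw [hrowi i, hrowi' i hi]
    ring
  · -- `G₀ = P'(·, 0; ·)`
    set f : ℂ[X][X] →+* ℂ := Polynomial.eval₂RingHom (Polynomial.evalRingHom x₀) x₁ with hf
    rw [eval_map_eq_rowSum G₀ _ hG₀deg, eval_map_eq_rowSum P' _ hP'deg]
    refine Finset.sum_congr rfl fun i hi => ?_
    have hi' := Finset.mem_range.1 hi
    rw [hG₀c, hP'c, if_pos hi', if_pos hi', hκ, RingEquiv.apply_symm_apply,
      ← Polynomial.coeff_zero_eq_eval_zero, Polynomial.coeff_map]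
  · -- a coefficient of `G₀` not divisible by `F`
    obtain ⟨i, hi⟩ := hr
    have hin : i < n + 1 := by
      by_contra h
      apply hi
      have h0 : P.coeff i = 0 := Polynomial.coeff_eq_zero_of_natDegree_lt (by omega)
      have : Q i = 0 := by rw [show Q i = κ (P.coeff i) from rfl, h0, map_zero]
      rw [this, Polynomial.coeff_zero]
      exact dvd_zero F
    refine ⟨i, ?_⟩
    rw [hG₀c, if_pos hin, hSh0]
    exact hi

end YOneAdicReduction

end Summit.Schanuel.Schanuel.Theorems

end
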